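import Mathlib
import HarnessLib

/-!
# ζ(5) search — certificates: LIST-BASED window tables for the kernel multiplier (TYPER g16)

HONEST FRAMING: systematic search; no irrationality claim unless certified.  Pure list combinatorics; nothing about `ζ(5)`.

OUR work (Summit side; typer seat, generation 16).  A kernel assembly with hundreds of prime windows cannot use `![…]` vector
literals (the elaborator's recursion depth) nor an `N²` pairwise-disjointness `decide`.  This file provides the list-based format
used by the `<NS>KernelBricks` files: a window table is a `List WinEntry`, `WinEntry = ℚ × ℚ × ℕ × ℕ = (A, B, w, idx)`, indexed by
`Fin tab.length`, and

* `chainOK` — ONE linear Boolean pass checking `A_i ≤ B_i` and `B_i ≤ A_{i+1}` (run by `decide`);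
* `chainOK_le`, `chainOK_sorted` — its soundness: `A_i ≤ B_i`, and `B_i ≤ A_j` for all `i < j` (so the windows are pairwise separated);
* `sum_fin_getElem_eq_map_sum` — `Σ_{i : Fin tab.length} g(tab[i]) = (tab.map g).sum` (so a window rate is ONE list sum, run by `decide`);
* `getElem_all` — an entry of a table all of whose entries pass a Boolean check passes it.
-/

namespace Summit.KontsevichZagierPeriods.Zeta5Search.RayKernel

/-- A window-table entry `(A, B, w, idx)`: the `θ`-window `(A, B]`, its weight `w`, and an index into a certificate table. -/
abbrev WinEntry := ℚ × ℚ × ℕ × ℕ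

/-- The linear chain check: every entry has `A ≤ B`, and consecutive entries have `B_i ≤ A_{i+1}`. -/
def chainOK : List WinEntry → Bool
  | [] => true
  | [e] => decide (e.1 ≤ e.2.1)
  | e₁ :: e₂ :: t => decide (e₁.1 ≤ e₁.2.1) && decide (e₁.2.1 ≤ e₂.1) && chainOK (e₂ :: t)

/-- Unfolding the chain check on two leading entries. -/
theorem chainOK_cons_cons {e₁ e₂ : WinEntry} {t : List WinEntry} :
    chainOK (e₁ :: e₂ :: t) = true ↔ e₁.1 ≤ e₁.2.1 ∧ e₁.2.1 ≤ e₂.1 ∧ chainOK (e₂ :: t) = true := by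
  simp [chainOK, Bool.and_eq_true, decide_eq_true_eq, and_assoc]

/-- The chain check passes to the tail. -/
theorem chainOK_tail {e : WinEntry} {t : List WinEntry} (h : chainOK (e :: t) = true) : chainOK t = true := by
  cases t with
  | nil => rfl
  | cons e₂ t' => exact (chainOK_cons_cons.1 h).2.2

/-- The head entry of a checked table has `A ≤ B`. -/
theorem chainOK_head {e : WinEntry} {t : List WinEntry} (h : chainOK (e :: t) = true) : e.1 ≤ e.2.1 := by
  cases t with
  | nil => simpa [chainOK] using h
  | cons e₂ t' => exact (chainOK_cons_cons.1 h).1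

/-- **`A_i ≤ B_i`** for every entry of a checked table. -/
theorem chainOK_le {l : List WinEntry} (h : chainOK l = true) (i : ℕ) (hi : i < l.length) :
    (l[i]).1 ≤ (l[i]).2.1 := by
  induction l generalizing i with
  | nil => simp at hi
  | cons e t ih =>
    cases i with
    | zero => simpa using chainOK_head h
    | succ i' =>
      have hi' : i' < t.length := by simpa using hi
      simpa using ih (chainOK_tail h) i' hi'

/-- The left endpoints are monotone from the head: `A_0 ≤ A_j`. -/
theorem chainOK_head_le {l : List WinEntry} (h : chainOK l = true) (j : ℕ) (hj : j < l.length) :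
    (l[0]'(by omega)).1 ≤ (l[j]).1 := by
  induction l generalizing j with
  | nil => simp at hj
  | cons e t ih =>
    cases j with
    | zero => exact le_rfl
    | succ j' =>
      cases t with
      | nil => simp at hj
      | cons e₂ t' =>
        obtain ⟨h1, h2, h3⟩ := chainOK_cons_cons.1 h
        have hj' : j' < (e₂ :: t').length := by simpa using hj
        have := ih h3 j' hj'
        simp only [List.getElem_cons_succ, List.getElem_cons_zero] at this ⊢
        exact h1.trans (h2.trans this)

/-- **`B_i ≤ A_j` for `i < j`**: the windows of a checked table are sorted and separated. -/
theorem chainOK_sorted {l : List WinEntry} (h : chainOK l = true) (i j : ℕ) (hij : i < j) (hj : j < l.length) :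
    (l[i]'(by omega)).2.1 ≤ (l[j]).1 := by
  induction l generalizing i j with
  | nil => simp at hj
  | cons e t ih =>
    cases t with
    | nil => simp at hj; omega
    | cons e₂ t' =>
      obtain ⟨h1, h2, h3⟩ := chainOK_cons_cons.1 h
      cases j with
      | zero => omega
      | succ j' =>
        have hj' : j' < (e₂ :: t').length := by simpa using hj
        cases i with
        | zero =>
          have := chainOK_head_le h3 j' hj'
          simp only [List.getElem_cons_succ, List.getElem_cons_zero] at this ⊢
          exact h2.trans this
        | succ i' =>
          have := ih h3 i' j' (by omega) hj'
          simpa using this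

/-- **A window rate is a list sum**: `Σ_{i : Fin tab.length} g(tab[i]) = (tab.map g).sum`. -/
theorem sum_fin_getElem_eq_map_sum {M : Type*} [AddCommMonoid M] (l : List WinEntry) (g : WinEntry → M) :
    ∑ i : Fin l.length, g (l[(i : ℕ)]) = (l.map g).sum := by
  rw [← Fin.sum_ofFn, List.ofFn_getElem_eq_map]

/-- An entry of a table all of whose entries pass a Boolean check passes it. -/
theorem getElem_all {α : Type*} {l : List α} {P : α → Bool} (h : l.all P = true) (i : ℕ) (hi : i < l.length) :
    P (l[i]) = true :=
  List.all_eq_true.1 h _ (List.getElem_mem hi)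

end Summit.KontsevichZagierPeriods.Zeta5Search.RayKernel
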